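import Summits.QuantumFields.YangMills.Theorems.ParabolicTrajectoryLatticeGapOnTrajectoryStubNegReflectRP
import Literature.MathematicalPhysics.QuantumFieldTheory.SpeciesTimeReflection
import HarnessLib

/-!
# Crux `LatticeGapOnTrajectory` (stmt-QuantumFields-10523), line `orbit-kantorovich-finite-size`:
# slab clustering — the reflected autocorrelation as four real covariances

Helper file (`--supports stmt-QuantumFields-10523`) for the registered stub `stub_slabClustering`
(G-blind bookkeeping; nothing about mass gaps is asserted, everything here is proved).

* `norm_cov_complex_le` (registered helper): for bounded measurable complex `F`, `G` on a
  probability space, `‖∫ F G − ∫ F ∫ G‖ ≤ 4E` as soon as the four real covariances of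
  `Re F, Im F` with `Re G, Im G` are bounded by `E` (real and imaginary parts, `‖z‖ ≤ |Re z| + |Im z|`).
* `osCorr_negReflect_eq_cov`: by `Θ₀`- and `τ`-invariance of Wilson's torus measure
  (`integral_comp_negReflect_eq`, `wilsonMeasure_map_torusConfigShift`), the reflected autocorrelation
  `osCorr μ Θ₀ τ_N X X` is the complex covariance of `F = conj ∘ X ∘ Θ₀` and `G = X ∘ τ_N`.
* `norm_osCorr_negReflect_le_two_mul_sq`: the trivial bound `‖osCorr μ Θ₀ τ_N X X‖ ≤ 2B²`.
* `dependsOn_comp_negReflect_slab`: a slab observable of lattice times `1 … w` read on the reflected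
  field depends only on the links based at times `≥ 2L − w` (torus side `2L+1`).

References: Osterwalder–Seiler 1978 §2; Glimm–Jaffe 1987 §6.1.
-/

namespace Summit.QuantumFields.YangMills.Cruxes.LatticeGapOnTrajectory.OrbitKantorovichFiniteSize

open scoped BigOperators ComplexConjugate
open Filter MeasureTheory
open Literature.MathematicalPhysics.QuantumLattice
open Literature.MathematicalPhysics.QuantumFieldTheory

noncomputable section

namespace SlabClustering

/-! ### §1 A complex covariance through four real ones -/

section Complex

variable {Ω : Type*} [MeasurableSpace Ω] (ν : Measure Ω) [IsProbabilityMeasure ν]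

/-- **A complex covariance through four real ones.** For bounded measurable complex `F`, `G`:
if the four real covariances `∫ f g − ∫ f ∫ g` of `f ∈ {Re F, Im F}` with `g ∈ {Re G, Im G}` are
bounded by `E`, then `‖∫ F G − ∫ F ∫ G‖ ≤ 4E`. -/
theorem norm_cov_complex_le {F G : Ω → ℂ} (hF : Measurable F) (hG : Measurable G) {B : ℝ}
    (hFb : ∀ ω, ‖F ω‖ ≤ B) (hGb : ∀ ω, ‖G ω‖ ≤ B) {E : ℝ}
    (h11 : |(∫ ω, (F ω).re * (G ω).re ∂ν) - (∫ ω, (F ω).re ∂ν) * ∫ ω, (G ω).re ∂ν| ≤ E)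
    (h22 : |(∫ ω, (F ω).im * (G ω).im ∂ν) - (∫ ω, (F ω).im ∂ν) * ∫ ω, (G ω).im ∂ν| ≤ E)
    (h12 : |(∫ ω, (F ω).re * (G ω).im ∂ν) - (∫ ω, (F ω).re ∂ν) * ∫ ω, (G ω).im ∂ν| ≤ E)
    (h21 : |(∫ ω, (F ω).im * (G ω).re ∂ν) - (∫ ω, (F ω).im ∂ν) * ∫ ω, (G ω).re ∂ν| ≤ E) :
    ‖(∫ ω, F ω * G ω ∂ν) - (∫ ω, F ω ∂ν) * ∫ ω, G ω ∂ν‖ ≤ 4 * E := by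
  have hFi : Integrable F ν := integrable_of_measurable_bounded hF ⟨B, hFb⟩
  have hGi : Integrable G ν := integrable_of_measurable_bounded hG ⟨B, hGb⟩
  have hFGi : Integrable (fun ω => F ω * G ω) ν :=
    hGi.bdd_mul hF.aestronglyMeasurable (ae_of_all _ hFb)
  -- real/imaginary parts of integrals
  have reInt : ∀ {H : Ω → ℂ}, Integrable H ν → (∫ ω, H ω ∂ν).re = ∫ ω, (H ω).re ∂ν :=
    fun h => by simpa using (integral_re h).symm
  have imInt : ∀ {H : Ω → ℂ}, Integrable H ν → (∫ ω, H ω ∂ν).im = ∫ ω, (H ω).im ∂ν :=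
    fun h => by simpa using (integral_im h).symm
  -- integrability of the real products
  have hri : ∀ {u v : Ω → ℝ}, Measurable u → Measurable v → (∀ ω, |u ω| ≤ B) → (∀ ω, |v ω| ≤ B) →
      Integrable (fun ω => u ω * v ω) ν := fun hu hv hub hvb =>
    (Integrable.of_bound hv.aestronglyMeasurable B (ae_of_all _ fun ω => by
      rw [Real.norm_eq_abs]; exact hvb ω)).bdd_mul hu.aestronglyMeasurable
      (ae_of_all _ fun ω => by rw [Real.norm_eq_abs]; exact hub ω)
  have hF1 : Measurable fun ω => (F ω).re := Complex.measurable_re.comp hF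
  have hF2 : Measurable fun ω => (F ω).im := Complex.measurable_im.comp hF
  have hG1 : Measurable fun ω => (G ω).re := Complex.measurable_re.comp hG
  have hG2 : Measurable fun ω => (G ω).im := Complex.measurable_im.comp hG
  have bF1 : ∀ ω, |(F ω).re| ≤ B := fun ω => (Complex.abs_re_le_norm _).trans (hFb ω)
  have bF2 : ∀ ω, |(F ω).im| ≤ B := fun ω => (Complex.abs_im_le_norm _).trans (hFb ω)
  have bG1 : ∀ ω, |(G ω).re| ≤ B := fun ω => (Complex.abs_re_le_norm _).trans (hGb ω)
  have bG2 : ∀ ω, |(G ω).im| ≤ B := fun ω => (Complex.abs_im_le_norm _).trans (hGb ω)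
  have hre : ((∫ ω, F ω * G ω ∂ν) - (∫ ω, F ω ∂ν) * ∫ ω, G ω ∂ν).re =
      ((∫ ω, (F ω).re * (G ω).re ∂ν) - (∫ ω, (F ω).re ∂ν) * ∫ ω, (G ω).re ∂ν) -
        ((∫ ω, (F ω).im * (G ω).im ∂ν) - (∫ ω, (F ω).im ∂ν) * ∫ ω, (G ω).im ∂ν) := by
    rw [Complex.sub_re, Complex.mul_re, reInt hFGi, reInt hFi, reInt hGi, imInt hFi, imInt hGi]
    simp only [Complex.mul_re]
    rw [integral_sub (hri hF1 hG1 bF1 bG1) (hri hF2 hG2 bF2 bG2)]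
    ring
  have him : ((∫ ω, F ω * G ω ∂ν) - (∫ ω, F ω ∂ν) * ∫ ω, G ω ∂ν).im =
      ((∫ ω, (F ω).re * (G ω).im ∂ν) - (∫ ω, (F ω).re ∂ν) * ∫ ω, (G ω).im ∂ν) +
        ((∫ ω, (F ω).im * (G ω).re ∂ν) - (∫ ω, (F ω).im ∂ν) * ∫ ω, (G ω).re ∂ν) := by
    rw [Complex.sub_im, Complex.mul_im, imInt hFGi, reInt hFi, reInt hGi, imInt hFi, imInt hGi]
    simp only [Complex.mul_im]
    rw [integral_add (hri hF1 hG2 bF1 bG2) (hri hF2 hG1 bF2 bG1)]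
    ring
  refine (Complex.norm_le_abs_re_add_abs_im _).trans ?_
  rw [hre, him]
  have e1 := abs_sub ((∫ ω, (F ω).re * (G ω).re ∂ν) - (∫ ω, (F ω).re ∂ν) * ∫ ω, (G ω).re ∂ν)
    ((∫ ω, (F ω).im * (G ω).im ∂ν) - (∫ ω, (F ω).im ∂ν) * ∫ ω, (G ω).im ∂ν)
  have e2 := abs_add_le ((∫ ω, (F ω).re * (G ω).im ∂ν) - (∫ ω, (F ω).re ∂ν) * ∫ ω, (G ω).im ∂ν)
    ((∫ ω, (F ω).im * (G ω).re ∂ν) - (∫ ω, (F ω).im ∂ν) * ∫ ω, (G ω).re ∂ν)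
  linarith

end Complex

/-! ### §2 The reflected autocorrelation of the torus Wilson state -/

section Torus

variable {G : Type} [Group G] [TopologicalSpace G] [IsTopologicalGroup G] [CompactSpace G]
  [MeasurableSpace G] [BorelSpace G] {Nr : ℕ} (ρ : G →* Matrix (Fin Nr) (Fin Nr) ℂ) {Sd : ℕ} [NeZero Sd]

/-- **The reflected autocorrelation as a complex covariance.** By `Θ₀`-invariance
(`integral_comp_negReflect_eq`) and time-translation invariance (`wilsonMeasure_map_torusConfigShift`)
of Wilson's torus measure `μ`, `osCorr μ Θ₀ τ_N X X = ∫ F G dμ − ∫ F dμ ∫ G dμ` with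
`F = conj ∘ X ∘ Θ₀`, `G = X ∘ τ_N`. -/
theorem osCorr_negReflect_eq_cov (hρ : Continuous ρ) (β : ℝ) (N : ℕ) {X : GaugeConfig 4 Sd G → ℂ}
    (hX : Measurable X) :
    osCorr (wilsonMeasure (d := 4) (L := Sd) ρ β) GaugeConfig.negReflect (torusTimeShift Sd N) X X =
      (∫ U, conj (X (GaugeConfig.negReflect U)) * X (torusTimeShift Sd N U) ∂(wilsonMeasure ρ β)) -
        (∫ U, conj (X (GaugeConfig.negReflect U)) ∂(wilsonMeasure ρ β)) *
          ∫ U, X (torusTimeShift Sd N U) ∂(wilsonMeasure ρ β) := by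
  have hτ : MeasurePreserving (torusTimeShift Sd N) (wilsonMeasure (d := 4) (L := Sd) ρ β)
      (wilsonMeasure ρ β) :=
    ⟨(torusConfigShift _).measurable, by unfold torusTimeShift; exact wilsonMeasure_map_torusConfigShift ρ β _⟩
  unfold osCorr
  rw [integral_conj, integral_comp_negReflect_eq ρ hρ β X, integral_comp_eq_of_measurePreserving hτ hX]

/-- **The trivial bound** `‖osCorr μ Θ₀ τ_N X X‖ ≤ 2B²` for `‖X‖ ≤ B`. -/
theorem norm_osCorr_negReflect_le_two_mul_sq (hρ : Continuous ρ) (β : ℝ) (N : ℕ)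
    {X : GaugeConfig 4 Sd G → ℂ} {B : ℝ} (hXb : ∀ U, ‖X U‖ ≤ B) :
    ‖osCorr (wilsonMeasure (d := 4) (L := Sd) ρ β) GaugeConfig.negReflect (torusTimeShift Sd N) X X‖ ≤
      2 * B ^ 2 := by
  haveI := isProbabilityMeasure_wilsonMeasure (d := 4) (L := Sd) ρ hρ β
  have hB : 0 ≤ B := (norm_nonneg _).trans (hXb fun _ => 1)
  have h1 : ‖∫ U, conj (X (GaugeConfig.negReflect U)) * X (torusTimeShift Sd N U)
      ∂(wilsonMeasure (d := 4) (L := Sd) ρ β)‖ ≤ B ^ 2 := by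
    refine (norm_integral_le_of_norm_le_const (C := B ^ 2) (ae_of_all _ fun U => ?_)).trans ?_
    · rw [norm_mul, RCLike.norm_conj, sq]
      exact mul_le_mul (hXb _) (hXb _) (norm_nonneg _) hB
    · simp
  have h2 : ‖∫ U, X U ∂(wilsonMeasure (d := 4) (L := Sd) ρ β)‖ ≤ B := by
    refine (norm_integral_le_of_norm_le_const (C := B) (ae_of_all _ fun U => hXb U)).trans ?_
    simp
  unfold osCorr
  refine (norm_sub_le _ _).trans ?_
  rw [norm_mul, RCLike.norm_conj]
  nlinarith [norm_nonneg (∫ U, X U ∂(wilsonMeasure (d := 4) (L := Sd) ρ β))]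

end Torus

/-! ### §3 Slab observables read on the reflected field -/

section Slab

variable {G : Type} [Group G] {L : ℕ}

/-- `(−t).val = 2L + 1 − t` for `1 ≤ t ≤ 2L+1`. -/
theorem val_neg_natCast {t : ℕ} (h1 : 1 ≤ t) (h2 : t ≤ 2 * L + 1) :
    (-((t : ℕ) : ZMod (2 * L + 1))).val = 2 * L + 1 - t := by
  have : (-((t : ℕ) : ZMod (2 * L + 1))) = ((2 * L + 1 - t : ℕ) : ZMod (2 * L + 1)) := by
    rw [Nat.cast_sub h2, ZMod.natCast_self, zero_sub]
  rw [this, ZMod.val_natCast_of_lt (by omega)]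

/-- **A slab observable on the reflected field.** If `X` depends only on the links based at lattice
times `1 … w` (`w ≤ L`) of the torus of side `2L+1`, then `X ∘ Θ₀` depends only on the links based at
times `≥ 2L − w` (spatial links at `u ↦ −u`, temporal links based at `u ↦ −u−1`). -/
theorem dependsOn_comp_negReflect_slab {α : Type*} {X : GaugeConfig 4 (2 * L + 1) G → α} {w : ℕ}
    (hw : w ≤ L) (hX : DependsOn X {e : Edge 4 (2 * L + 1) | 1 ≤ (e.1 0).val ∧ (e.1 0).val ≤ w}) :
    DependsOn (fun U => X (GaugeConfig.negReflect U)) {e : Edge 4 (2 * L + 1) | 2 * L - w ≤ (e.1 0).val} := by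
  intro U V hUV
  apply hX
  intro e he
  simp only [Set.mem_setOf_eq] at he
  obtain ⟨x, i⟩ := e
  set t : ℕ := (x 0).val with ht
  have hxt : x 0 = (t : ZMod (2 * L + 1)) := (ZMod.natCast_zmod_val (x 0)).symm
  show GaugeConfig.negReflect U (x, i) = GaugeConfig.negReflect V (x, i)
  unfold GaugeConfig.negReflect
  by_cases hi : i = 0
  · simp only [hi, ↓reduceIte]
    rw [hUV _ ?_]
    simp only [Set.mem_setOf_eq, WilsonSiteRP.negReflect_apply_zero, WilsonRP.shift_apply_self, hxt]
    rw [← Nat.cast_succ, val_neg_natCast (by omega) (by omega)]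
    omega
  · simp only [hi, ↓reduceIte]
    rw [hUV _ ?_]
    simp only [Set.mem_setOf_eq, WilsonSiteRP.negReflect_apply_zero, hxt]
    rw [val_neg_natCast (by omega) (by omega)]
    omega

end Slab

end SlabClustering

end

end Summit.QuantumFields.YangMills.Cruxes.LatticeGapOnTrajectory.OrbitKantorovichFiniteSize
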